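import Literature.NumberTheory.LFunctions.MatomakiRadziwillTaoPropA3
import Literature.NumberTheory.LFunctions.MatomakiRadziwillTaoPropA3Proofs
import HarnessLib

/-!
# Discharges of named facts of `MatomakiRadziwillTaoTheoremA2.lean`

`Literature/NumberTheory/LFunctions/MatomakiRadziwillTaoTheoremA2Holds.lean` — proofs-only
sibling of `MatomakiRadziwillTaoTheoremA2.lean` (no definitions, no named facts). Each theorem
below closes a named fact `X : Prop` of that file as `X_holds : X` by composing an ACCEPTED
reduction theorem of the tree with the ACCEPTED unconditional `_holds` discharges of all of
its hypotheses; nothing is re-proved and no statement is changed. Recorded by the librarian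
sweep g25 (2026-08-16, pass 5c: facts dischargeable in one line from the tree's own lemmas),
so that the facts census, `#h21_route_deps` and the cone guardrail see these facts as
theorems.

Discharged here:

* `MatomakiRadziwillTao2015_theoremA2_holds` := `MatomakiRadziwillTao2015_theoremA2_of_propA3`
  `MatomakiRadziwillTao2015_propA3_holds` (`MatomakiRadziwillTaoPropA3.lean`).

## References

* [MatomakiRadziwillTao2015] — see `lean/references.bib` and the docstring of the fact in `MatomakiRadziwillTaoTheoremA2.lean`.
-/

namespace Literature.NumberTheory.LFunctions

/-- **Discharge of the named fact `MatomakiRadziwillTao2015_theoremA2`**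
(`MatomakiRadziwillTaoTheoremA2.lean`): NAMED FACT — Matomäki–Radziwiłł–Tao 2015, Theorem A.2
(Algebra & Number Theory 9 (2015), Appendix A, p. 2190), with the standing assumptions of
Appendix A: "Let `η ∈ (0, 1/6)`, and let `X₀` be a quantity with `√X ≤ X₀ ≤ X`. … — obtained
as `MatomakiRadziwillTao2015_theoremA2_of_propA3` applied to the tree's unconditional
discharge `MatomakiRadziwillTao2015_propA3_holds` of its hypothesis (reduction in
`MatomakiRadziwillTaoPropA3.lean`).
[cite: MatomakiRadziwillTao2015, Appendix A, Theorem A.2] -/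
theorem MatomakiRadziwillTao2015_theoremA2_holds :
    MatomakiRadziwillTao2015_theoremA2 :=
  MatomakiRadziwillTao2015_theoremA2_of_propA3 MatomakiRadziwillTao2015_propA3_holds

end Literature.NumberTheory.LFunctions
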